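import Literature.NumberTheory.Sieve.QuadraticRootsPrimeModuliDFIBilinearBlocks
import HarnessLib

/-!
# Duke–Friedlander–Iwaniec 1995, §7 (iii-b): `R(w, y)` for `ρ_h` at a given `x` (PROVED)

Topic `Literature/NumberTheory/Sieve`.  The deterministic half of "(35) follows from
Proposition 2" (§7 of W. Duke, J. B. Friedlander, H. Iwaniec, Ann. of Math. 141 (1995), p. 438),
completed (choice of `x₀`, comparison with `x (log x)^{−10}`) in
`QuadraticRootsPrimeModuliDFIBilinear.lean`:

* `DFI1995.norm_sieveR₂_rho_le` — with `L = 1 + log x`, `Δ = L^{−14}`, `N_k = w(1+Δ)^k`,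
  `K = ⌈log(y/w)/log(1+Δ)⌉`, the fibres `N_k ≤ n < N_{k+1}` of the range `w ≤ n < y` give
  `|R(w,y)| ≤ 8C_f log x (L(ΔxL + y) + y√x) + K · (2 log x + 1) K₂ 2C_f log x √(L³) (√2 x/√w + √3 x^{7/8+ε'} y^{3/8})`
  for `c_n = ρ_h(n)`, `|α_m| ≤ ω(m)`, `|β_n| ≤ 1` on primes, `x ≥ e`, `w ≥ 2`, `0 ≤ y ≤ x`
  (the range is the disjoint union of the fibres — `Nat.find` on `n < N_{k+1}` —; on each fibre
  the cutoff `m ≤ x/n` is freed at the cost bounded in the previous file, and the fixed-cutoff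
  fibre sum is bounded by `DFI1995.norm_fiberSum_fiber_le`);
* `DFI1995.norm_fiberSum_fiber_le` — the main term of one fibre in final form, from
  `DFI1995.norm_fiberSum_le` and the two real-variable estimates `DFI1995.fiber_term1_le`
  (`√X √s (X/2)^{1/2} ≤ x/√N'` for `X = x/(2N')`, `s ≤ 2N'Δ + 1`) and `DFI1995.fiber_term2_le`
  (`√X √s N'^{3/4}(X/2)^{3/8+ε'} ≤ √3 x^{7/8+ε'} y^{3/8}` for `s ≤ 3N'`, `N' ≤ y`);
* small lemmas: `log(1+Δ) ≥ Δ/2`, `C u⁴ ≤ e^u` for large `u`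
  (`DFI1995.exists_pow_four_mul_le_exp`), `#S ≤ Q − P + 1` for `S ⊆ [P, Q]`.

Everything in this file is proved.

## References

* W. Duke, J. B. Friedlander, H. Iwaniec, Ann. of Math. (2) 141 (1995), 423–441: (33), (35)
  (pp. 436–437), §7 (p. 438). [cite: DukeFriedlanderIwaniec1995, §7]
-/

namespace Literature.NumberTheory.Sieve

open scoped BigOperators Polynomial
open Filter Asymptotics Finset Polynomial

namespace DFI1995

/-! ### Real-variable bookkeeping for the fibre bounds -/

/-- First term of a fibre: `√X √s (X/2)^{1/2} ≤ x/√N'` for `X = x/(2N')`, `s ≤ 2N'Δ + 1`,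
`Δ ≤ 1/2`, `N' ≥ 1` (`s` may be negative: `√s = 0` then). [folklore] -/
theorem fiber_term1_le {x N' Δ s : ℝ} (hx : 0 ≤ x) (hN' : 1 ≤ N') (hΔ : Δ ≤ 1 / 2)
    (hs : s ≤ 2 * N' * Δ + 1) :
    Real.sqrt (x / (2 * N')) * Real.sqrt s * (x / (2 * N') / 2) ^ (1 / 2 : ℝ) ≤
      x / Real.sqrt N' := by
  have hN'0 : 0 < N' := by linarith
  set X : ℝ := x / (2 * N') with hX
  have hX0 : 0 ≤ X := by positivity
  have h1 : (X / 2) ^ (1 / 2 : ℝ) ≤ Real.sqrt X := by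
    rw [← Real.sqrt_eq_rpow]
    exact Real.sqrt_le_sqrt (by linarith)
  have h2 : Real.sqrt s ≤ 2 * Real.sqrt N' := by
    rw [show (2 : ℝ) * Real.sqrt N' = Real.sqrt (4 * N') by
      rw [Real.sqrt_mul (by norm_num), show (4 : ℝ) = 2 ^ 2 by norm_num,
        Real.sqrt_sq (by norm_num)]]
    exact Real.sqrt_le_sqrt (by nlinarith)
  calc Real.sqrt X * Real.sqrt s * (X / 2) ^ (1 / 2 : ℝ)
      ≤ Real.sqrt X * (2 * Real.sqrt N') * Real.sqrt X := by
        gcongr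
    _ = 2 * X * Real.sqrt N' := by
        have hXX := Real.mul_self_sqrt hX0
        calc Real.sqrt X * (2 * Real.sqrt N') * Real.sqrt X
            = 2 * Real.sqrt N' * (Real.sqrt X * Real.sqrt X) := by ring
          _ = 2 * X * Real.sqrt N' := by rw [hXX]; ring
    _ = x / Real.sqrt N' := by
        rw [hX]
        have hsq : Real.sqrt N' * Real.sqrt N' = N' := Real.mul_self_sqrt hN'0.le
        have hsq0 : 0 < Real.sqrt N' := Real.sqrt_pos.2 hN'0
        field_simp
        nlinarith [hsq]

/-- Second term of a fibre: `√X √s N'^{3/4} (X/2)^{3/8+ε'} ≤ √3 x^{7/8+ε'} y^{3/8}` for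
`X = x/(2N')`, `s ≤ 3N'`, `1 ≤ N' ≤ y`, `0 ≤ ε'`. [folklore] -/
theorem fiber_term2_le {x N' y s ε' : ℝ} (hx : 0 < x) (hN' : 1 ≤ N') (hN'y : N' ≤ y)
    (hs : s ≤ 3 * N') (hε'0 : 0 ≤ ε') :
    Real.sqrt (x / (2 * N')) * Real.sqrt s * (N' ^ (3 / 4 : ℝ) * (x / (2 * N') / 2) ^ (3 / 8 + ε')) ≤
      Real.sqrt 3 * x ^ (7 / 8 + ε') * y ^ (3 / 8 : ℝ) := by
  have hN'0 : 0 < N' := by linarith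
  set X : ℝ := x / (2 * N') with hX
  have hX0 : 0 < X := by positivity
  -- `√X (X/2)^{3/8+ε'} ≤ X^{7/8+ε'}`
  have h1 : Real.sqrt X * (X / 2) ^ (3 / 8 + ε') ≤ X ^ (7 / 8 + ε') := by
    rw [Real.sqrt_eq_rpow]
    calc X ^ (1 / 2 : ℝ) * (X / 2) ^ (3 / 8 + ε') ≤ X ^ (1 / 2 : ℝ) * X ^ (3 / 8 + ε') := by
          gcongr; linarith
      _ = X ^ (7 / 8 + ε') := by
          rw [← Real.rpow_add hX0, show (1 / 2 + (3 / 8 + ε') : ℝ) = 7 / 8 + ε' by ring]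
  -- `√s N'^{3/4} ≤ √3 N'^{5/4}`
  have h2 : Real.sqrt s * N' ^ (3 / 4 : ℝ) ≤ Real.sqrt 3 * N' ^ (5 / 4 : ℝ) := by
    have : Real.sqrt s ≤ Real.sqrt 3 * N' ^ (1 / 2 : ℝ) := by
      rw [← Real.sqrt_eq_rpow, ← Real.sqrt_mul (by norm_num)]
      exact Real.sqrt_le_sqrt hs
    calc Real.sqrt s * N' ^ (3 / 4 : ℝ) ≤ Real.sqrt 3 * N' ^ (1 / 2 : ℝ) * N' ^ (3 / 4 : ℝ) := by
          gcongr
      _ = Real.sqrt 3 * N' ^ (5 / 4 : ℝ) := by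
          rw [mul_assoc, ← Real.rpow_add hN'0]; norm_num
  -- `X^{7/8+ε'} N'^{5/4} ≤ x^{7/8+ε'} N'^{3/8}`
  have h3 : X ^ (7 / 8 + ε') * N' ^ (5 / 4 : ℝ) ≤ x ^ (7 / 8 + ε') * N' ^ (3 / 8 : ℝ) := by
    have hXle : X ≤ x / N' := by
      rw [hX]; exact div_le_div_of_nonneg_left hx.le hN'0 (by linarith)
    calc X ^ (7 / 8 + ε') * N' ^ (5 / 4 : ℝ) ≤ (x / N') ^ (7 / 8 + ε') * N' ^ (5 / 4 : ℝ) := by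
          gcongr
      _ = x ^ (7 / 8 + ε') * (N' ^ (5 / 4 : ℝ) / N' ^ (7 / 8 + ε')) := by
          rw [Real.div_rpow hx.le hN'0.le]; ring
      _ = x ^ (7 / 8 + ε') * N' ^ (3 / 8 - ε') := by
          rw [← Real.rpow_sub hN'0, show (5 / 4 - (7 / 8 + ε') : ℝ) = 3 / 8 - ε' by ring]
      _ ≤ x ^ (7 / 8 + ε') * N' ^ (3 / 8 : ℝ) :=
          mul_le_mul_of_nonneg_left (Real.rpow_le_rpow_of_exponent_le hN' (by linarith))
            (by positivity)
  have h4 : N' ^ (3 / 8 : ℝ) ≤ y ^ (3 / 8 : ℝ) := Real.rpow_le_rpow hN'0.le hN'y (by norm_num)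
  calc Real.sqrt X * Real.sqrt s * (N' ^ (3 / 4 : ℝ) * (X / 2) ^ (3 / 8 + ε'))
      = (Real.sqrt X * (X / 2) ^ (3 / 8 + ε')) * (Real.sqrt s * N' ^ (3 / 4 : ℝ)) := by ring
    _ ≤ X ^ (7 / 8 + ε') * (Real.sqrt 3 * N' ^ (5 / 4 : ℝ)) :=
        mul_le_mul h1 h2 (by positivity) (by positivity)
    _ = Real.sqrt 3 * (X ^ (7 / 8 + ε') * N' ^ (5 / 4 : ℝ)) := by ring
    _ ≤ Real.sqrt 3 * (x ^ (7 / 8 + ε') * N' ^ (3 / 8 : ℝ)) :=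
        mul_le_mul_of_nonneg_left h3 (Real.sqrt_nonneg _)
    _ ≤ Real.sqrt 3 * (x ^ (7 / 8 + ε') * y ^ (3 / 8 : ℝ)) := by gcongr
    _ = Real.sqrt 3 * x ^ (7 / 8 + ε') * y ^ (3 / 8 : ℝ) := by ring

/-- `log(1 + Δ) ≥ Δ/2` for `0 ≤ Δ ≤ 1`. [folklore] -/
theorem half_mul_le_log_one_add {Δ : ℝ} (hΔ0 : 0 ≤ Δ) (hΔ1 : Δ ≤ 1) :
    Δ / 2 ≤ Real.log (1 + Δ) := by
  have h1 : 0 < 1 + Δ := by linarith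
  have h2 := Real.log_le_sub_one_of_pos (inv_pos.2 h1)
  rw [Real.log_inv] at h2
  have h3 : (1 + Δ)⁻¹ = 1 - Δ / (1 + Δ) := by field_simp; ring
  rw [h3] at h2
  have h4 : Δ / (1 + Δ) ≥ Δ / 2 := div_le_div_of_nonneg_left hΔ0 h1 (by linarith)
  linarith

/-- The growth lemma behind `w^{−1/2} = o((log x)^{−A})`: for every `C` there is `u₀` with
`C u⁴ ≤ e^u` for `u ≥ u₀`. [folklore] -/
theorem exists_pow_four_mul_le_exp (C : ℝ) : ∃ u₀ : ℝ, ∀ u : ℝ, u₀ ≤ u → C * u ^ 4 ≤ Real.exp u := by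
  have ht := Real.tendsto_pow_mul_exp_neg_atTop_nhds_zero 4
  have hev : ∀ᶠ u : ℝ in atTop, u ^ 4 * Real.exp (-u) ≤ 1 / (|C| + 1) :=
    ht.eventually (ge_mem_nhds (by positivity))
  obtain ⟨u₀, hu₀⟩ := Filter.eventually_atTop.1 hev
  refine ⟨u₀, fun u hu => ?_⟩
  have h1 := hu₀ u hu
  have hC : C ≤ |C| + 1 := by have := le_abs_self C; linarith
  have hpos : 0 < |C| + 1 := by positivity
  rw [Real.exp_neg, ← div_eq_mul_inv, div_le_div_iff₀ (Real.exp_pos u) hpos, one_mul] at h1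
  have h4 : 0 ≤ u ^ 4 := by positivity
  nlinarith

/-! ### The bound for `R(w, y)` at a given `x` -/

/-- If every `n ∈ S` satisfies `P ≤ n ≤ Q` then `#S ≤ Q − P + 1` (for nonempty `S`). [folklore] -/
theorem card_le_of_bounds {S : Finset ℕ} {P Q : ℝ} (hne : S.Nonempty)
    (hS : ∀ n ∈ S, P ≤ (n : ℝ) ∧ (n : ℝ) ≤ Q) : (S.card : ℝ) ≤ Q - P + 1 := by
  obtain ⟨n₀, hn₀⟩ := hne
  have hPQ : P ≤ Q := (hS n₀ hn₀).1.trans (hS n₀ hn₀).2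
  have hsub : S ⊆ Icc ⌈P⌉₊ ⌊Q⌋₊ := fun n hn =>
    Finset.mem_Icc.2 ⟨Nat.ceil_le.2 (hS n hn).1, Nat.le_floor (hS n hn).2⟩
  have hQ0 : 0 ≤ Q := le_trans (Nat.cast_nonneg n₀) (hS n₀ hn₀).2
  calc (S.card : ℝ) ≤ ((Icc ⌈P⌉₊ ⌊Q⌋₊).card : ℝ) := by exact_mod_cast Finset.card_le_card hsub
    _ = ((⌊Q⌋₊ + 1 - ⌈P⌉₊ : ℕ) : ℝ) := by rw [Nat.card_Icc]
    _ ≤ Q - P + 1 := by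
        rcases le_or_gt ⌈P⌉₊ (⌊Q⌋₊ + 1) with hle | hlt
        · rw [Nat.cast_sub hle]; push_cast
          have h1 : (⌊Q⌋₊ : ℝ) ≤ Q := Nat.floor_le hQ0
          have h2 : P ≤ (⌈P⌉₊ : ℝ) := Nat.le_ceil P
          linarith
        · rw [Nat.sub_eq_zero_of_le hlt.le]; push_cast; linarith

/-- **The main term of one fibre, in final form**: for a fibre `S` of integers in
`[N_k, N_{k+1})`, `N_{k+1} = (1+Δ)N_k ≥ w ≥ 2`, meeting `[1, y)`, and the cutoff `X = x/N_{k+1}`,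
`|T_S(X)| ≤ (2 log x + 1) K₂ 2C log x √(L³) (√2 x/√w + √3 x^{7/8+ε'} y^{3/8})`. [folklore] -/
theorem norm_fiberSum_fiber_le {f : ℤ[X]} {h : ℤ} {C K₂ ε' x w y Δ Nk Nk1 : ℝ} {α β : ℕ → ℂ}
    {S : Finset ℕ} (hC : 0 ≤ C) (hK₂ : 0 ≤ K₂) (hε'0 : 0 ≤ ε')
    (hρ0 : ∀ n : ℕ, 1 ≤ n → ‖polyRootWeylSum f n 0‖ ≤ C * (Nat.divisors n).card)
    (hα : ∀ m : ℕ, ‖α m‖ ≤ ArithmeticFunction.cardDistinctFactors m) (hβ : ∀ n : ℕ, ‖β n‖ ≤ 1)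
    (hK₂N' : ∀ M : ℝ, 1 ≤ M → ∀ S' : Finset ℕ,
      (∀ n ∈ S', Nk1 / 2 < (n : ℝ) ∧ (n : ℝ) ≤ 2 * (Nk1 / 2)) →
      ‖bilinearForm f h (blockAlpha α M) (fiberBeta β S') M (Nk1 / 2)‖ ≤
        K₂ * normAlphaRho f (blockAlpha α M) M * l2Norm (fiberBeta β S') (Nk1 / 2) *
          (M ^ (1 / 2 : ℝ) + (Nk1 / 2) ^ (3 / 4 : ℝ) * M ^ (3 / 8 + ε')))
    (hx1 : 1 ≤ x) (hw : 2 ≤ w) (hy0 : 0 ≤ y) (hΔ0 : 0 < Δ) (hΔ : Δ ≤ 1 / 2) (hwNk : w ≤ Nk)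
    (hNk1 : Nk1 = (1 + Δ) * Nk)
    (hS : ∀ n ∈ S, 1 ≤ n ∧ (n : ℝ) < y ∧ Nk ≤ (n : ℝ) ∧ (n : ℝ) < Nk1) :
    ‖fiberSum f h α β S (x / Nk1)‖ ≤
      (2 * Real.log x + 1) * (K₂ * (2 * C * Real.log x) * Real.sqrt ((1 + Real.log x) ^ 3)) *
        (Real.sqrt 2 * x / Real.sqrt w + Real.sqrt 3 * x ^ (7 / 8 + ε') * y ^ (3 / 8 : ℝ)) := by
  have hx0 : 0 < x := by linarith
  have hw0 : 0 < w := by linarith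
  have hNk0 : 0 < Nk := by linarith
  have hNk10 : 0 < Nk1 := by rw [hNk1]; positivity
  have hlx0 : 0 ≤ Real.log x := Real.log_nonneg hx1
  rcases S.eq_empty_or_nonempty with hSe | hne
  · rw [hSe]; unfold fiberSum
    simp only [Finset.sum_empty, norm_zero]
    have hy : 0 ≤ y ^ (3 / 8 : ℝ) := Real.rpow_nonneg hy0 _
    positivity
  · obtain ⟨n₀, hn₀⟩ := hne
    obtain ⟨-, hn₀y, hNn₀, -⟩ := hS n₀ hn₀
    set N' : ℝ := Nk1 / 2 with hN'
    have hN'1 : 1 ≤ N' := by rw [hN', hNk1]; nlinarith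
    have hN'0 : 0 < N' := by linarith
    have hXk : x / Nk1 = x / (2 * N') := by rw [hN']; congr 1; ring
    have hN'y : N' ≤ y := by
      have h2 : Nk < y := lt_of_le_of_lt hNn₀ hn₀y
      rw [hN', hNk1]; nlinarith
    have hSsub : S ⊆ Icc 1 ⌊2 * N'⌋₊ := fun n hn => by
      obtain ⟨hn1, -, -, hnN⟩ := hS n hn
      refine Finset.mem_Icc.2 ⟨hn1, Nat.le_floor ?_⟩
      rw [hN']; linarith
    have hSbd : ∀ n ∈ S, N' < (n : ℝ) ∧ (n : ℝ) ≤ 2 * N' := fun n hn => by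
      obtain ⟨-, -, hNn, hnN⟩ := hS n hn
      constructor
      · rw [hN', hNk1]; nlinarith
      · rw [hN']; linarith
    have hblock := fun M (hM : (1 : ℝ) ≤ M) => hK₂N' M hM S hSbd
    have hXk0 : 0 ≤ x / Nk1 := by positivity
    have hXkx : x / Nk1 ≤ x := div_le_self hx0.le (by linarith)
    have hfib := norm_fiberSum_le hC hK₂ hε'0 hρ0 hα hβ hSsub hblock hN'0.le hXk0 hXkx hx1
    have hs : (S.card : ℝ) ≤ 2 * N' * Δ + 1 := by
      have h1 := card_le_of_bounds ⟨n₀, hn₀⟩ (fun n hn => ⟨(hS n hn).2.2.1, (hS n hn).2.2.2.le⟩)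
      have h2 : Nk1 - Nk = Δ * Nk := by rw [hNk1]; ring
      have h3 : Nk ≤ 2 * N' := by rw [hN', hNk1]; nlinarith
      have h4 : Δ * Nk ≤ Δ * (2 * N') := mul_le_mul_of_nonneg_left h3 hΔ0.le
      linarith
    have hs3 : (S.card : ℝ) ≤ 3 * N' := by
      have : 2 * N' * Δ ≤ N' := by nlinarith
      linarith
    have ht1 := fiber_term1_le (s := (S.card : ℝ)) hx0.le hN'1 hΔ hs
    have ht2 := fiber_term2_le (s := (S.card : ℝ)) hx0 hN'1 hN'y hs3 hε'0
    have hN'w : x / Real.sqrt N' ≤ Real.sqrt 2 * x / Real.sqrt w := by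
      have h1 : w / 2 ≤ N' := by rw [hN', hNk1]; nlinarith
      have h2 : Real.sqrt (w / 2) ≤ Real.sqrt N' := Real.sqrt_le_sqrt h1
      have h3 : Real.sqrt (w / 2) = Real.sqrt w / Real.sqrt 2 := Real.sqrt_div hw0.le 2
      have hsw : 0 < Real.sqrt w := Real.sqrt_pos.2 hw0
      have hs2 : 0 < Real.sqrt 2 := by positivity
      have hw2pos : 0 < Real.sqrt (w / 2) := by rw [h3]; positivity
      calc x / Real.sqrt N' ≤ x / Real.sqrt (w / 2) := div_le_div_of_nonneg_left hx0.le hw2pos h2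
        _ = Real.sqrt 2 * x / Real.sqrt w := by rw [h3]; field_simp
    rw [hXk] at hfib ⊢
    refine hfib.trans ?_
    have hsqrt : Real.sqrt (x / (2 * N') * (1 + Real.log x) ^ 3) =
        Real.sqrt (x / (2 * N')) * Real.sqrt ((1 + Real.log x) ^ 3) :=
      Real.sqrt_mul (by positivity) _
    rw [hsqrt]
    have hcore : Real.sqrt (x / (2 * N')) * Real.sqrt (S.card) *
        ((x / (2 * N') / 2) ^ (1 / 2 : ℝ) + N' ^ (3 / 4 : ℝ) * (x / (2 * N') / 2) ^ (3 / 8 + ε')) ≤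
        Real.sqrt 2 * x / Real.sqrt w + Real.sqrt 3 * x ^ (7 / 8 + ε') * y ^ (3 / 8 : ℝ) := by
      rw [mul_add]
      exact add_le_add (ht1.trans hN'w) ht2
    have hpre : 0 ≤ (2 * Real.log x + 1) *
        (K₂ * (2 * C * Real.log x) * Real.sqrt ((1 + Real.log x) ^ 3)) := by positivity
    calc (2 * Real.log x + 1) * (K₂ * (2 * C * Real.log x *
          (Real.sqrt (x / (2 * N')) * Real.sqrt ((1 + Real.log x) ^ 3))) * Real.sqrt (S.card) *
          ((x / (2 * N') / 2) ^ (1 / 2 : ℝ) + N' ^ (3 / 4 : ℝ) * (x / (2 * N') / 2) ^ (3 / 8 + ε')))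
        = (2 * Real.log x + 1) * (K₂ * (2 * C * Real.log x) * Real.sqrt ((1 + Real.log x) ^ 3)) *
            (Real.sqrt (x / (2 * N')) * Real.sqrt (S.card) *
              ((x / (2 * N') / 2) ^ (1 / 2 : ℝ) + N' ^ (3 / 4 : ℝ) * (x / (2 * N') / 2) ^ (3 / 8 + ε'))) := by
          ring
      _ ≤ _ := mul_le_mul_of_nonneg_left hcore hpre

/-- **`R(w, y)` for `ρ_h` at a given `x`**: with `L = 1 + log x`, `Δ = L^{−14}`,
`N_k = w (1+Δ)^k`, `K = ⌈log(y/w)/log(1+Δ)⌉`, the fibres `N_k ≤ n < N_{k+1}` give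
`|R(w,y)| ≤ 8C log x (L(ΔxL + y) + y√x) + K · (2 log x + 1) K₂ 2C log x √(L³) (√2 x/√w + √3 x^{7/8+ε'} y^{3/8})`
(cutoff replacement + Proposition 2 on the dyadic blocks). [folklore] -/
theorem norm_sieveR₂_rho_le {f : ℤ[X]} {h : ℤ} {C K₂ ε' x w y : ℝ} {α β : ℕ → ℂ}
    (hC : 0 ≤ C) (hK₂ : 0 ≤ K₂) (hε'0 : 0 ≤ ε')
    (hρ : ∀ h' : ℤ, ∀ n : ℕ, 1 ≤ n → ‖polyRootWeylSum f n h'‖ ≤ C * (Nat.divisors n).card)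
    (hK₂all : ∀ M N' : ℝ, 1 ≤ M → 1 ≤ N' → ∀ (α β : ℕ → ℂ) (S : Finset ℕ),
      (∀ n ∈ S, N' < (n : ℝ) ∧ (n : ℝ) ≤ 2 * N') → (∀ n : ℕ, ¬ n.Prime → β n = 0) →
      ‖bilinearForm f h (blockAlpha α M) (fiberBeta β S) M N'‖ ≤
        K₂ * normAlphaRho f (blockAlpha α M) M * l2Norm (fiberBeta β S) N' *
          (M ^ (1 / 2 : ℝ) + N' ^ (3 / 4 : ℝ) * M ^ (3 / 8 + ε')))
    (hα : ∀ m : ℕ, ‖α m‖ ≤ ArithmeticFunction.cardDistinctFactors m) (hβ : ∀ n : ℕ, ‖β n‖ ≤ 1)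
    (hβp : ∀ n : ℕ, ¬ n.Prime → β n = 0)
    (hx : Real.exp 1 ≤ x) (hw : 2 ≤ w) (hy0 : 0 ≤ y) (hyx : y ≤ x) :
    ‖sieveR₂ (rhoSeq f h) α β x w y‖ ≤
      8 * C * Real.log x * ((1 + Real.log x) * ((1 + Real.log x)⁻¹ ^ 14 * x * (1 + Real.log x) + y) +
          y * Real.sqrt x) +
        (⌈Real.log (y / w) / Real.log (1 + (1 + Real.log x)⁻¹ ^ 14)⌉₊ : ℝ) *
          ((2 * Real.log x + 1) * (K₂ * (2 * C * Real.log x) * Real.sqrt ((1 + Real.log x) ^ 3)) *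
            (Real.sqrt 2 * x / Real.sqrt w + Real.sqrt 3 * x ^ (7 / 8 + ε') * y ^ (3 / 8 : ℝ))) := by
  -- basic facts about `x`
  have hx1 : (1 : ℝ) ≤ x := le_trans (by have := Real.add_one_le_exp (1 : ℝ); linarith) hx
  have hx0 : (0 : ℝ) < x := by linarith
  have hlogx : 1 ≤ Real.log x := by
    rw [← Real.log_exp 1]; exact Real.log_le_log (Real.exp_pos 1) hx
  set L : ℝ := 1 + Real.log x with hL
  have hL2 : 2 ≤ L := by linarith
  have hL0 : 0 < L := by linarith
  set Δ : ℝ := L⁻¹ ^ 14 with hΔdef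
  have hΔ0 : 0 < Δ := by positivity
  have hΔ : Δ ≤ 1 / 2 := by
    rw [hΔdef, inv_pow]
    have : (2 : ℝ) ^ 14 ≤ L ^ 14 := pow_le_pow_left₀ (by norm_num) hL2 14
    calc (L ^ 14)⁻¹ ≤ ((2 : ℝ) ^ 14)⁻¹ := by
          apply inv_anti₀ (by positivity) this
      _ ≤ 1 / 2 := by norm_num
  have hw0 : 0 < w := by linarith
  set N : ℕ → ℝ := fun k => w * (1 + Δ) ^ k with hNdef
  have hN0 : ∀ k, 0 < N k := fun k => by positivity
  have hNsucc : ∀ k, N (k + 1) = (1 + Δ) * N k := fun k => by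
    simp only [hNdef, pow_succ]; ring
  have hNmono : ∀ k₁ k₂, k₁ ≤ k₂ → N k₁ ≤ N k₂ := fun k₁ k₂ hk => by
    simp only [hNdef]
    exact mul_le_mul_of_nonneg_left (pow_le_pow_right₀ (by linarith) hk) hw0.le
  have hNge : ∀ k, w ≤ N k := fun k => by
    have := hNmono 0 k (Nat.zero_le _); simpa [hNdef] using this
  set Kmax : ℕ := ⌈Real.log (y / w) / Real.log (1 + Δ)⌉₊ with hKmax
  have hlog1Δ : 0 < Real.log (1 + Δ) := Real.log_pos (by linarith)
  -- `N_{Kmax} ≥ y` as soon as `y > w`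
  have hNK : w < y → y ≤ N Kmax := by
    intro hyw
    have hy0 : 0 < y := hw0.trans hyw
    have ht0 : 0 ≤ Real.log (y / w) / Real.log (1 + Δ) :=
      div_nonneg (Real.log_nonneg ((one_le_div hw0).2 hyw.le)) hlog1Δ.le
    have h1 : (1 + Δ) ^ (Real.log (y / w) / Real.log (1 + Δ)) = y / w := by
      rw [Real.rpow_def_of_pos (by linarith), mul_div_cancel₀ _ hlog1Δ.ne', Real.exp_log (by positivity)]
    have h2 : y / w ≤ (1 + Δ) ^ Kmax := by
      rw [← h1, ← Real.rpow_natCast]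
      exact Real.rpow_le_rpow_of_exponent_le (by linarith) (Nat.le_ceil _)
    calc y = w * (y / w) := by field_simp
      _ ≤ w * (1 + Δ) ^ Kmax := mul_le_mul_of_nonneg_left h2 hw0.le
  -- the fibres
  set F₂ : Finset ℕ := (Icc 1 ⌊x⌋₊).filter (fun n : ℕ => w ≤ (n : ℝ) ∧ (n : ℝ) < y) with hF₂
  set S : ℕ → Finset ℕ := fun k => F₂.filter (fun n : ℕ => N k ≤ (n : ℝ) ∧ (n : ℝ) < N (k + 1))
    with hSdef
  have hF₂mem : ∀ n ∈ F₂, 1 ≤ n ∧ (n : ℝ) ≤ x ∧ w ≤ (n : ℝ) ∧ (n : ℝ) < y := fun n hn => by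
    rw [hF₂, Finset.mem_filter, Finset.mem_Icc] at hn
    exact ⟨hn.1.1, le_trans (by exact_mod_cast hn.1.2) (Nat.floor_le hx0.le), hn.2.1, hn.2.2⟩
  have hSmem : ∀ k, ∀ n ∈ S k, (1 ≤ n ∧ (n : ℝ) ≤ x ∧ w ≤ (n : ℝ) ∧ (n : ℝ) < y) ∧
      N k ≤ (n : ℝ) ∧ (n : ℝ) < N (k + 1) := fun k n hn => by
    rw [hSdef, Finset.mem_filter] at hn
    exact ⟨hF₂mem n hn.1, hn.2.1, hn.2.2⟩
  have hcover : F₂ = (Finset.range Kmax).biUnion S := by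
    ext n
    constructor
    · intro hn
      obtain ⟨-, -, hwn, hny⟩ := hF₂mem n hn
      have hyw : w < y := lt_of_le_of_lt hwn hny
      have hNK' := hNK hyw
      have hK1 : 1 ≤ Kmax := by
        rw [hKmax]
        refine Nat.one_le_iff_ne_zero.2 (fun h0 => ?_)
        have := Nat.ceil_eq_zero.1 h0
        have hpos : 0 < Real.log (y / w) / Real.log (1 + Δ) :=
          div_pos (Real.log_pos ((one_lt_div hw0).2 hyw)) hlog1Δ
        linarith
      have hex : ∃ k : ℕ, (n : ℝ) < N (k + 1) :=
        ⟨Kmax - 1, by rw [Nat.sub_add_cancel hK1]; linarith⟩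
      classical
      set k₀ := Nat.find hex with hk₀def
      have hk₀ : (n : ℝ) < N (k₀ + 1) := Nat.find_spec hex
      have hlow : N k₀ ≤ n := by
        rcases Nat.eq_zero_or_pos k₀ with h0 | hpos
        · rw [h0]; simpa [hNdef] using hwn
        · have hm : ¬ (n : ℝ) < N (k₀ - 1 + 1) := Nat.find_min hex (by omega)
          rw [Nat.sub_add_cancel hpos] at hm
          exact not_lt.1 hm
      have hk₀K : k₀ < Kmax := by
        have : k₀ ≤ Kmax - 1 := Nat.find_min' hex (by rw [Nat.sub_add_cancel hK1]; linarith)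
        omega
      exact Finset.mem_biUnion.2 ⟨k₀, Finset.mem_range.2 hk₀K,
        Finset.mem_filter.2 ⟨hn, hlow, hk₀⟩⟩
    · intro hn
      obtain ⟨k, -, hk⟩ := Finset.mem_biUnion.1 hn
      exact (Finset.mem_filter.1 hk).1
  have hdisj : Set.PairwiseDisjoint (↑(Finset.range Kmax) : Set ℕ) S := by
    intro k₁ _ k₂ _ hne
    rw [Function.onFun, Finset.disjoint_left]
    intro n h1 h2
    obtain ⟨-, ha1, hb1⟩ := hSmem k₁ n h1
    obtain ⟨-, ha2, hb2⟩ := hSmem k₂ n h2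
    rcases lt_or_gt_of_ne hne with hlt | hlt
    · have := hNmono (k₁ + 1) k₂ hlt; linarith
    · have := hNmono (k₂ + 1) k₁ hlt; linarith
  -- Step 1: split `R(w, y)` over the fibres
  have hR : sieveR₂ (rhoSeq f h) α β x w y = ∑ k ∈ Finset.range Kmax, ∑ n ∈ S k,
      β n * ∑ m ∈ (Icc 1 (⌊x⌋₊ / n)).filter (fun m : ℕ => Nat.Coprime m n),
        α m * polyRootWeylSum f (m * n) h := by
    unfold sieveR₂
    rw [← Finset.sum_biUnion hdisj, ← hcover]
    rfl
  -- Step 2: per fibre, error + main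
  set X : ℕ → ℝ := fun k => x / N (k + 1) with hXdef
  set errTerm : ℕ → ℝ := fun n => 8 * C * Real.log x * ((Δ * x / n + 1) * (1 + Real.log x) + Real.sqrt x)
    with herr
  set MainFib : ℝ := (2 * Real.log x + 1) * (K₂ * (2 * C * Real.log x) * Real.sqrt (L ^ 3)) *
    (Real.sqrt 2 * x / Real.sqrt w + Real.sqrt 3 * x ^ (7 / 8 + ε') * y ^ (3 / 8 : ℝ)) with hMainFib
  have hlx0 : 0 ≤ Real.log x := by linarith
  have hMainFib0 : 0 ≤ MainFib := by
    rw [hMainFib]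
    have : 0 ≤ y ^ (3 / 8 : ℝ) := Real.rpow_nonneg hy0 _
    positivity
  -- Step 3: the cutoff error on each fibre, and its sum
  have herrk : ∀ k ∈ Finset.range Kmax,
      ‖(∑ n ∈ S k, β n * ∑ m ∈ (Icc 1 (⌊x⌋₊ / n)).filter (fun m : ℕ => Nat.Coprime m n),
          α m * polyRootWeylSum f (m * n) h) - fiberSum f h α β (S k) (X k)‖ ≤
        ∑ n ∈ S k, errTerm n := by
    intro k _
    exact norm_fiber_sub_fiberSum_le (Nk := N k) (Nk1 := N (k + 1)) hC (hρ h) hα hβ hβp hx1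
      hΔ0.le (hN0 k) (le_of_eq (hNsucc k))
      (fun n hn => ⟨(hSmem k n hn).1.1, (hSmem k n hn).1.2.1, (hSmem k n hn).2.1, (hSmem k n hn).2.2⟩)
  have hF₂sub : F₂ ⊆ Icc 1 ⌊y⌋₊ := fun n hn => by
    obtain ⟨h1, -, -, h4⟩ := hF₂mem n hn
    exact Finset.mem_Icc.2 ⟨h1, Nat.le_floor h4.le⟩
  have herrsum : ∑ n ∈ F₂, errTerm n ≤
      8 * C * Real.log x * (L * (Δ * x * L + y) + y * Real.sqrt x) := by
    have hsplit : ∀ n ∈ F₂, errTerm n =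
        8 * C * Real.log x * (L * Δ * x) * ((n : ℝ))⁻¹ + 8 * C * Real.log x * (L + Real.sqrt x) := by
      intro n _; rw [herr, hL]; ring
    rw [Finset.sum_congr rfl hsplit, Finset.sum_add_distrib, ← Finset.mul_sum, Finset.sum_const,
      nsmul_eq_mul]
    have hinv : ∑ n ∈ F₂, ((n : ℝ))⁻¹ ≤ L := by
      calc ∑ n ∈ F₂, ((n : ℝ))⁻¹ ≤ ∑ n ∈ Icc 1 ⌊y⌋₊, ((n : ℝ))⁻¹ :=
            Finset.sum_le_sum_of_subset_of_nonneg hF₂sub fun _ _ _ => by positivity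
        _ ≤ 1 + Real.log ⌊y⌋₊ := by
            have := Vaughan.sum_Ioc_inv_le ⌊y⌋₊
            rwa [Vaughan.Ioc_zero_eq_Icc_one] at this
        _ ≤ L := by
            rw [hL]
            have : Real.log (⌊y⌋₊ : ℝ) ≤ Real.log x := by
              rcases Nat.eq_zero_or_pos ⌊y⌋₊ with h0 | hpos
              · rw [h0, Nat.cast_zero, Real.log_zero]; exact hlx0
              · exact Real.log_le_log (by exact_mod_cast hpos) ((Nat.floor_le hy0).trans hyx)
            linarith
    have hcardF : (F₂.card : ℝ) ≤ y := by
      calc (F₂.card : ℝ) ≤ ((Icc 1 ⌊y⌋₊).card : ℝ) := by exact_mod_cast Finset.card_le_card hF₂sub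
        _ = ⌊y⌋₊ := by rw [Nat.card_Icc]; push_cast; ring
        _ ≤ y := Nat.floor_le hy0
    have h8 : 0 ≤ 8 * C * Real.log x := by positivity
    calc 8 * C * Real.log x * (L * Δ * x) * ∑ n ∈ F₂, ((n : ℝ))⁻¹ +
          (F₂.card : ℝ) * (8 * C * Real.log x * (L + Real.sqrt x))
        ≤ 8 * C * Real.log x * (L * Δ * x) * L + y * (8 * C * Real.log x * (L + Real.sqrt x)) := by
          gcongr
      _ = 8 * C * Real.log x * (L * (Δ * x * L + y) + y * Real.sqrt x) := by ring
  -- Step 4: the main term on each fibre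
  have hmaink : ∀ k ∈ Finset.range Kmax, ‖fiberSum f h α β (S k) (X k)‖ ≤ MainFib := by
    intro k _
    have := norm_fiberSum_fiber_le (S := S k) hC hK₂ hε'0 (hρ 0) hα hβ
      (fun M hM S' hS' => hK₂all M (N (k + 1) / 2) hM
        (by have := hNge (k + 1); linarith) α β S' hS' hβp)
      hx1 hw hy0 hΔ0 hΔ (hNge k) (hNsucc k)
      (fun n hn => ⟨(hSmem k n hn).1.1, (hSmem k n hn).1.2.2.2, (hSmem k n hn).2.1,
        (hSmem k n hn).2.2⟩)
    simpa only [hXdef, hMainFib, hL] using this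
  -- Step 5: assemble
  rw [hR]
  calc ‖∑ k ∈ Finset.range Kmax, ∑ n ∈ S k, β n *
        ∑ m ∈ (Icc 1 (⌊x⌋₊ / n)).filter (fun m : ℕ => Nat.Coprime m n), α m * polyRootWeylSum f (m * n) h‖
      ≤ ∑ k ∈ Finset.range Kmax, ‖∑ n ∈ S k, β n *
        ∑ m ∈ (Icc 1 (⌊x⌋₊ / n)).filter (fun m : ℕ => Nat.Coprime m n), α m * polyRootWeylSum f (m * n) h‖ :=
        norm_sum_le _ _
    _ ≤ ∑ k ∈ Finset.range Kmax, (∑ n ∈ S k, errTerm n + MainFib) := by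
        refine Finset.sum_le_sum fun k hk => ?_
        calc ‖∑ n ∈ S k, β n * ∑ m ∈ (Icc 1 (⌊x⌋₊ / n)).filter (fun m : ℕ => Nat.Coprime m n),
              α m * polyRootWeylSum f (m * n) h‖
            = ‖((∑ n ∈ S k, β n * ∑ m ∈ (Icc 1 (⌊x⌋₊ / n)).filter (fun m : ℕ => Nat.Coprime m n),
                α m * polyRootWeylSum f (m * n) h) - fiberSum f h α β (S k) (X k)) +
                fiberSum f h α β (S k) (X k)‖ := by rw [sub_add_cancel]
          _ ≤ ‖(∑ n ∈ S k, β n * ∑ m ∈ (Icc 1 (⌊x⌋₊ / n)).filter (fun m : ℕ => Nat.Coprime m n),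
                α m * polyRootWeylSum f (m * n) h) - fiberSum f h α β (S k) (X k)‖ +
                ‖fiberSum f h α β (S k) (X k)‖ := norm_add_le _ _
          _ ≤ ∑ n ∈ S k, errTerm n + MainFib := add_le_add (herrk k hk) (hmaink k hk)
    _ = ∑ n ∈ F₂, errTerm n + Kmax * MainFib := by
        rw [Finset.sum_add_distrib, ← Finset.sum_biUnion hdisj, ← hcover, Finset.sum_const,
          Finset.card_range, nsmul_eq_mul]
    _ ≤ 8 * C * Real.log x * (L * (Δ * x * L + y) + y * Real.sqrt x) + Kmax * MainFib :=
        add_le_add herrsum le_rfl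

end DFI1995

end Literature.NumberTheory.Sieve
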